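import Mathlib
import HarnessLib
import Literature.MathematicalPhysics.QuantumFieldTheory.LatticeGaugeStaticPotentialProofs
import Literature.MathematicalPhysics.QuantumFieldTheory.PlaquetteWeightSiteRPConjugate
import Summits.Ventures.LatticeQCDFlow.Exactness.OpenBoundaryTimeReflection
import Summits.Ventures.LatticeQCDFlow.Scoring.WilsonStapleSum

/-!
# Axis permutations fixing the open direction preserve the open-boundary Gibbs law; weighted actions with symmetric weights; the clover charge density flips sign under an axis transposition

HONEST FRAMING: exact (Metropolis-corrected) sampling algorithms for lattice gauge theory;
figures of merit are autocorrelation/cost numbers at stated couplings and volumes; no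
continuum-physics claim.

Venture `LatticeQCDFlow` (cell pub-lqcd), topic `Exactness`, FANOUT row 21 (`su3-base`, arms `PBC-HMC` / `1HB+4OR` on the
torus and `OBC-HMC`).  NEW WORK of the cell over the tree.  IMPORTED, NOT RESTATED: the Literature's coordinate permutations
of the torus (`LatticeGaugeStaticPotentialProofs`, part (B): `sitePerm π`, `edgePerm π`, the measurable equivalence
`configPerm π` — `(configPerm π U)(x, i) = U(π⁻¹x, π⁻¹i)` —, `plaquetteHolonomy_configPerm`, and the PERIODIC statements
`wilsonAction_configPerm`, `wilsonMeasure_map_configPerm`, `wilsonExpectation_comp_configPerm`, which are therefore not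
repeated here; `WeightSiteRP.measurePreserving_configPerm` of `PlaquetteWeightSiteRPConjugate`: `configPerm π` preserves
`Haar^⊗`); `PTBCWilsonDefect.weightedWilsonAction`; row 16's `Scoring/WilsonStapleSum` (`plane`, `plaqRe_plane`);
`OpenBoundaryWilsonAction` (`obcWeight`, `obcAction`); `OpenBoundaryTimeReflection` (`weightedWilsonAction_eq_sum_plaqRe`);
the Literature clover `cloverLeafSum` / `flowedClover` / `cloverPseudoscalar` with `flowedClover_swap`.
Def-free; nothing is cited as a fact; no number.

## What is proved

* §1 (any `d`, `L ≥ 1`, compact `G`, continuous `ρ`) `plane_eq_plane_iff`, `plaqPerm_injective`, `plaqRe_configPerm`;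
  **`weightedWilsonAction_configPerm`** — `S_w(configPerm π U) = S_w(U)` whenever the WEIGHTS are symmetric under the axis
  permutation (`w (π⁻¹x, {π⁻¹i, π⁻¹j}) = w (x, {i, j})`); `obcWeight_sitePerm` (the open-boundary weights are symmetric
  under every `π` fixing the open direction `τ`), **`obcAction_configPerm`** (`S_OBC(configPerm π U) = S_OBC(U)`, `π τ = τ`).
* §2 **`obcGibbs_map_configPerm`** — THE OPEN-BOUNDARY
  GIBBS LAW `Z⁻¹ e^{−βS_OBC} · Haar^⊗` IS INVARIANT UNDER EVERY AXIS PERMUTATION FIXING THE OPEN DIRECTION (every real `β`);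
  the `MeasurePreserving` form and `∫ F(configPerm π U) = ∫ F(U)`.
* §3 (`d = 4`) `sitePerm_sub`, `cloverLeafSum_configPerm`, `flowedClover_zero_configPerm`
  (`C_{μν}(x)[configPerm π U] = C_{π⁻¹μ,π⁻¹ν}(π⁻¹x)[U]`), **`cloverPseudoscalar_configPerm_swap`** — under the transposition
  of the axes `1 ↔ 2` the bare clover charge density flips sign: `P_x[configPerm (swap 1 2) U] = −P_{s x}[U]` (a pseudoscalar).
Sequel (`OpenBoundaryChargeDensity.lean`): with the spatial translations of `OpenBoundaryTranslation` the sign flip gives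
`⟨P_x⟩_OBC = 0` at every site for the open direction `0` as well.

NOT CLAIMED: the periodic statements (Literature, above); reflections of a single spatial axis or general hypercubic
elements beyond permutations; anything after flow / cooling; numbers.
-/

noncomputable section

namespace Summit.Ventures.LatticeQCDFlow.Exactness

open MeasureTheory Set Function
open Literature.MathematicalPhysics.QuantumFieldTheory
open Literature.MathematicalPhysics.QuantumLattice (cloverPseudoscalar cloverLeafSum measurable_cloverPseudoscalar
  fundamentalRep continuous_fundamentalRep fundamentalRep_mem_unitaryGroup)
open scoped ENNReal

/-! ## §1 Axis permutations on plaquettes and weighted actions -/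

section Geometry

variable {d L N : ℕ} {G : Type*} [Group G] (π : Equiv.Perm (Fin d))

/-- Two ordered planes agree iff their unordered pairs of directions agree. -/
theorem plane_eq_plane_iff {a b a' b' : Fin d} (h : a ≠ b) (h' : a' ≠ b') :
    Scoring.plane a b h = Scoring.plane a' b' h' ↔ (a = a' ∧ b = b') ∨ (a = b' ∧ b = a') := by
  unfold Scoring.plane
  constructor
  · intro e
    split_ifs at e with h1 h2 h2 <;> simp only [Subtype.mk.injEq, Prod.mk.injEq] at e
    · exact Or.inl e
    · exact Or.inr e
    · exact Or.inr ⟨e.2, e.1⟩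
    · exact Or.inl ⟨e.2, e.1⟩
  · rintro (⟨rfl, rfl⟩ | ⟨rfl, rfl⟩)
    · rfl
    · exact Scoring.plane_comm h

/-- For `i < j` the ordered plane is `(i, j)` itself. -/
theorem plane_of_lt {i j : Fin d} (hij : i < j) : Scoring.plane i j (ne_of_lt hij) = ⟨(i, j), hij⟩ := by
  unfold Scoring.plane
  rw [dif_pos hij]

/-- **The plaquette map of an axis permutation is injective**: `p = (x; i<j) ↦ (sitePerm π x, {πi, πj})`. -/
theorem plaqPerm_injective : Function.Injective fun p : Plaquette d L =>
    ((sitePerm π p.1, Scoring.plane (π p.2.1.1) (π p.2.1.2) (π.injective.ne (ne_of_lt p.2.2))) : Plaquette d L) := by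
  rintro ⟨x, ⟨⟨i, j⟩, hij⟩⟩ ⟨y, ⟨⟨i', j'⟩, hij'⟩⟩ h
  simp only [Prod.mk.injEq] at h
  obtain ⟨hx, hpl⟩ := h
  have hxy : x = y := (sitePerm π).injective hx
  subst hxy
  rcases (plane_eq_plane_iff _ _).1 hpl with ⟨h1, h2⟩ | ⟨h1, h2⟩
  · have hi := π.injective h1
    have hj := π.injective h2
    subst hi; subst hj; rfl
  · have hi := π.injective h1
    have hj := π.injective h2
    simp only at hij hij'
    subst hi; subst hj
    exact absurd (lt_trans hij hij') (lt_irrefl _)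

/-- A direction lies in the ordered plane `{a, b}` iff it is `a` or `b`. -/
theorem plane_mem_iff {a b : Fin d} (h : a ≠ b) (τ : Fin d) :
    ((Scoring.plane a b h).1.1 = τ ∨ (Scoring.plane a b h).1.2 = τ) ↔ (a = τ ∨ b = τ) := by
  unfold Scoring.plane
  split_ifs
  · exact Iff.rfl
  · exact or_comm

/-- **The open-boundary weights are symmetric under every axis permutation fixing the open direction `τ`.** -/
theorem obcWeight_sitePerm {τ : Fin d} (hτ : π τ = τ) (x : Site d L) (i j : Fin d) (h : i ≠ j) :
    obcWeight τ (sitePerm π x, Scoring.plane (π i) (π j) (π.injective.ne h)) = obcWeight τ (x, Scoring.plane i j h) := by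
  have hτ' : π.symm τ = τ := by rw [Equiv.symm_apply_eq]; exact hτ.symm
  have hs : sitePerm π x τ = x τ := by rw [sitePerm_apply, hτ']
  have hmem : (π i = τ ∨ π j = τ) ↔ (i = τ ∨ j = τ) := by
    constructor
    · rintro (h1 | h1)
      · exact Or.inl (π.injective (h1.trans hτ.symm))
      · exact Or.inr (π.injective (h1.trans hτ.symm))
    · rintro (rfl | rfl)
      · exact Or.inl hτ
      · exact Or.inr hτ
  have h1 := (plane_mem_iff (π.injective.ne h) τ).trans hmem
  have h2 := plane_mem_iff h τ
  unfold obcWeight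
  simp only [hs, h1, h2]

variable [MeasurableSpace G] [TopologicalSpace G] [IsTopologicalGroup G] [CompactSpace G]
  (ρ : G →* Matrix (Fin N) (Fin N) ℂ) (w : Plaquette d L → ℝ)

/-- `Re tr ρ` of a plaquette of the permuted configuration is that of the permuted plaquette (compact `G`, continuous `ρ`:
the orientation is immaterial). -/
theorem plaqRe_configPerm (hρ : Continuous ρ) (U : GaugeConfig d L G) (p : Plaquette d L) :
    WilsonRP.plaqRe ρ (configPerm π U) p =
      WilsonRP.plaqRe ρ U (sitePerm π.symm p.1,
        Scoring.plane (π.symm p.2.1.1) (π.symm p.2.1.2) (π.symm.injective.ne (ne_of_lt p.2.2))) := by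
  rw [Scoring.plaqRe_plane ρ hρ]
  unfold WilsonRP.plaqRe
  rw [plaquetteHolonomy_configPerm]

variable [NeZero L]

/-- **`S_w(configPerm π U) = S_w(U)` for weights symmetric under the axis permutation** (compact `G`, continuous `ρ`,
every `d`, `L ≥ 1`; the symmetry is asked of `π⁻¹`, equivalently of `π`). -/
theorem weightedWilsonAction_configPerm (hρ : Continuous ρ)
    (hw : ∀ (x : Site d L) (i j : Fin d) (h : i ≠ j),
      w (sitePerm π.symm x, Scoring.plane (π.symm i) (π.symm j) (π.symm.injective.ne h)) = w (x, Scoring.plane i j h))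
    (U : GaugeConfig d L G) :
    weightedWilsonAction w ρ (configPerm π U) = weightedWilsonAction w ρ U := by
  rw [weightedWilsonAction_eq_sum_plaqRe, weightedWilsonAction_eq_sum_plaqRe]
  simp_rw [plaqRe_configPerm π ρ hρ U]
  refine Fintype.sum_bijective _ ((Finite.injective_iff_bijective).1 (plaqPerm_injective (L := L) π.symm)) _ _
    fun p => ?_
  obtain ⟨x, ⟨⟨i, j⟩, hij⟩⟩ := p
  have hwp := hw x i j (ne_of_lt hij)
  rw [plane_of_lt hij] at hwp
  simp only
  rw [hwp]

/-- **`S_OBC(configPerm π U) = S_OBC(U)`** for every axis permutation fixing the open direction. -/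
theorem obcAction_configPerm (hρ : Continuous ρ) {τ : Fin d} (hτ : π τ = τ) (U : GaugeConfig d L G) :
    obcAction ρ τ (configPerm π U) = obcAction ρ τ U :=
  have hτ' : π.symm τ = τ := by rw [Equiv.symm_apply_eq]; exact hτ.symm
  weightedWilsonAction_configPerm π ρ (obcWeight τ) hρ (fun x i j h => obcWeight_sitePerm π.symm hτ' x i j h) U

end Geometry

/-! ## §2 The open-boundary Gibbs law is invariant under axis permutations fixing the open direction -/

section Measures

variable {d L N : ℕ} [NeZero L] {G : Type*} [Group G] [TopologicalSpace G] [IsTopologicalGroup G] [CompactSpace G]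
  [MeasurableSpace G] [BorelSpace G] (π : Equiv.Perm (Fin d)) (ρ : G →* Matrix (Fin N) (Fin N) ℂ)

/-- **THE OPEN-BOUNDARY GIBBS LAW IS INVARIANT UNDER EVERY AXIS PERMUTATION FIXING THE OPEN DIRECTION** (compact `G`,
continuous `ρ`, every real `β`, every `d`, `L ≥ 1`). -/
theorem obcGibbs_map_configPerm (hρ : Continuous ρ) {τ : Fin d} (hτ : π τ = τ) (β : ℝ) :
    (gibbsProbability (Measure.pi fun _ : Edge d L => haarProbability G) (fun U => Real.exp (-(β * obcAction ρ τ U)))).map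
        (configPerm π) =
      gibbsProbability (Measure.pi fun _ : Edge d L => haarProbability G) (fun U => Real.exp (-(β * obcAction ρ τ U))) := by
  unfold gibbsProbability
  rw [Measure.map_smul]
  congr 1
  exact WilsonGauge.withDensity_map_equiv_of_invariant _ _ _ (WeightSiteRP.measurePreserving_configPerm (G := G) (L := L) π).map_eq
    fun U => by beta_reduce; rw [obcAction_configPerm π ρ hρ hτ U]

/-- `configPerm π` (`π τ = τ`) preserves the open-boundary Gibbs law. -/
theorem measurePreserving_configPerm_obcGibbs (hρ : Continuous ρ) {τ : Fin d} (hτ : π τ = τ) (β : ℝ) :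
    MeasurePreserving (configPerm π)
      (gibbsProbability (Measure.pi fun _ : Edge d L => haarProbability G) (fun U => Real.exp (-(β * obcAction ρ τ U))))
      (gibbsProbability (Measure.pi fun _ : Edge d L => haarProbability G) (fun U => Real.exp (-(β * obcAction ρ τ U)))) :=
  ⟨MeasurableEquiv.measurable _, obcGibbs_map_configPerm π ρ hρ hτ β⟩

/-- **`⟨F(configPerm π U)⟩_OBC = ⟨F⟩_OBC`** for every observable and every axis permutation fixing the open direction. -/
theorem obcGibbs_integral_comp_configPerm (hρ : Continuous ρ) {τ : Fin d} (hτ : π τ = τ) (β : ℝ) {V : Type*}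
    [NormedAddCommGroup V] [NormedSpace ℝ V] (F : GaugeConfig d L G → V) :
    ∫ U, F (configPerm π U) ∂(gibbsProbability
        (Measure.pi fun _ : Edge d L => haarProbability G) (fun U => Real.exp (-(β * obcAction ρ τ U)))) =
      ∫ U, F U ∂(gibbsProbability (Measure.pi fun _ : Edge d L => haarProbability G)
        (fun U => Real.exp (-(β * obcAction ρ τ U)))) :=
  (measurePreserving_configPerm_obcGibbs π ρ hρ hτ β).integral_comp' F

end Measures

/-! ## §3 The clover charge density under axis permutations (`d = 4`); a transposition flips its sign -/

section Clover

variable {d L N : ℕ} {G : Type*} [Group G] [MeasurableSpace G] (ρ : G →* Matrix (Fin N) (Fin N) ℂ)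

omit [Group G] [MeasurableSpace G] in
/-- `sitePerm` commutes with subtraction. -/
theorem sitePerm_sub (π : Equiv.Perm (Fin d)) (x y : Site d L) : sitePerm π (x - y) = sitePerm π x - sitePerm π y := rfl

/-- The clover sum of the permuted link field: `Q_{μν}(x)[configPerm π U] = Q_{π⁻¹μ,π⁻¹ν}(π⁻¹ x)[U]`. -/
theorem cloverLeafSum_configPerm (π : Equiv.Perm (Fin 4)) (U : GaugeConfig 4 L G) (x : Site 4 L) (μ ν : Fin 4) :
    cloverLeafSum (fun e => ρ (configPerm π U e)) x μ ν =
      cloverLeafSum (fun e => ρ (U e)) (sitePerm π.symm x) (π.symm μ) (π.symm ν) := by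
  simp only [cloverLeafSum, configPerm_apply, sitePerm_add, sitePerm_sub, sitePerm_single]

/-- **`C_{μν}(x)[configPerm π U] = C_{π⁻¹μ,π⁻¹ν}(π⁻¹ x)[U]`** for the bare clover field tensor. -/
theorem flowedClover_zero_configPerm (π : Equiv.Perm (Fin 4)) (U : GaugeConfig 4 L G) (x : Site 4 L) (μ ν : Fin 4) :
    Literature.MathematicalPhysics.QuantumLattice.flowedClover ρ 0 (configPerm π U) x μ ν =
      Literature.MathematicalPhysics.QuantumLattice.flowedClover ρ 0 U (sitePerm π.symm x) (π.symm μ) (π.symm ν) := by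
  rw [Literature.MathematicalPhysics.QuantumLattice.flowedClover_zero,
    Literature.MathematicalPhysics.QuantumLattice.flowedClover_zero, cloverLeafSum_configPerm]

/-- **A PSEUDOSCALAR: under the transposition of the axes `1 ↔ 2` the bare clover charge density flips sign**,
`P_x[configPerm (swap 1 2) U] = −P_{s x}[U]` with `s = sitePerm (swap 1 2)` (unitary `ρ`: `C_{21} = −C_{12}`). -/
theorem cloverPseudoscalar_configPerm_swap (hρu : ∀ g, ρ g ∈ Matrix.unitaryGroup (Fin N) ℂ) (U : GaugeConfig 4 L G)
    (x : Site 4 L) :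
    cloverPseudoscalar ρ x (configPerm (Equiv.swap (1 : Fin 4) 2) U) =
      -cloverPseudoscalar ρ (sitePerm (Equiv.swap (1 : Fin 4) 2) x) U := by
  have hs : (Equiv.swap (1 : Fin 4) 2).symm = Equiv.swap (1 : Fin 4) 2 := Equiv.symm_swap 1 2
  have h0 : Equiv.swap (1 : Fin 4) 2 0 = 0 := Equiv.swap_apply_of_ne_of_ne (by decide) (by decide)
  have h1 : Equiv.swap (1 : Fin 4) 2 1 = 2 := Equiv.swap_apply_left 1 2
  have h2 : Equiv.swap (1 : Fin 4) 2 2 = 1 := Equiv.swap_apply_right 1 2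
  have h3 : Equiv.swap (1 : Fin 4) 2 3 = 3 := Equiv.swap_apply_of_ne_of_ne (by decide) (by decide)
  simp only [cloverPseudoscalar, flowedClover_zero_configPerm, hs, h0, h1, h2, h3]
  rw [Literature.MathematicalPhysics.QuantumLattice.flowedClover_swap ρ hρu 0 U _ 1 2]
  simp only [Matrix.mul_neg, Matrix.trace_add, Matrix.trace_sub, Matrix.trace_neg, Complex.add_re, Complex.sub_re,
    Complex.neg_re]
  ring

end Clover

end Summit.Ventures.LatticeQCDFlow.Exactness

/-! ## §4 (appended) Observables that are odd under an axis permutation fixing the open direction: zero mean, symmetric law, symmetric tails, vanishing odd moments under the open-boundary Gibbs law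

Appended section (GEN-5 of row 21): the `configPerm` twins of `OpenBoundaryTimeReflection`'s §4 (`R`-odd observables), for ANY
observable `F` with `F (configPerm π U) = −F U` and any axis permutation `π` fixing the open direction `τ` — the form the sequel
`OpenBoundaryChargeDensity` consumes for slab charges (row 16's abstract lemmas of `Scoring/CloverChargeLawSymmetric` /
`CloverChargeMeanZero` applied to `measurePreserving_configPerm_obcGibbs`).
-/

namespace Summit.Ventures.LatticeQCDFlow.Exactness

open MeasureTheory Set Function
open Literature.MathematicalPhysics.QuantumFieldTheory

section OddConfigPerm

variable {d L N : ℕ} [NeZero L] {G : Type*} [Group G] [TopologicalSpace G] [IsTopologicalGroup G] [CompactSpace G]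
  [MeasurableSpace G] [BorelSpace G] (π : Equiv.Perm (Fin d)) (ρ : G →* Matrix (Fin N) (Fin N) ℂ)

/-- **`configPerm π`-odd observables have zero open-boundary mean** (`π τ = τ`): `F (configPerm π U) = −F U` for all `U` gives
`∫ F = 0` (no integrability needed). -/
theorem obcGibbs_integral_eq_zero_of_configPerm_odd (hρ : Continuous ρ) {τ : Fin d} (hτ : π τ = τ) (β : ℝ) {V : Type*}
    [NormedAddCommGroup V] [NormedSpace ℝ V] {F : GaugeConfig d L G → V} (hF : ∀ U, F (configPerm π U) = -F U) :
    ∫ U, F U ∂(gibbsProbability (Measure.pi fun _ : Edge d L => haarProbability G)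
      (fun U => Real.exp (-(β * obcAction ρ τ U)))) = 0 :=
  Scoring.integral_eq_zero_of_measurePreserving_odd _ (measurePreserving_configPerm_obcGibbs π ρ hρ hτ β) hF

/-- **Tail symmetry** `P{c ≤ F} = P{F ≤ −c}` for every `configPerm π`-odd real observable (`π τ = τ`). -/
theorem obcGibbs_tail_symm_of_configPerm_odd (hρ : Continuous ρ) {τ : Fin d} (hτ : π τ = τ) (β : ℝ)
    {F : GaugeConfig d L G → ℝ} (hF : ∀ U, F (configPerm π U) = -F U) (c : ℝ) :
    gibbsProbability (Measure.pi fun _ : Edge d L => haarProbability G) (fun U => Real.exp (-(β * obcAction ρ τ U)))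
        {U | c ≤ F U} =
      gibbsProbability (Measure.pi fun _ : Edge d L => haarProbability G) (fun U => Real.exp (-(β * obcAction ρ τ U)))
        {U | F U ≤ -c} :=
  Scoring.measure_le_eq_measure_le_neg_of_odd _ (measurePreserving_configPerm_obcGibbs π ρ hρ hτ β) hF c

/-- **The law of a `configPerm π`-odd observable is symmetric about `0`** (a.e.-measurable `F`, `π τ = τ`). -/
theorem obcGibbs_map_neg_of_configPerm_odd (hρ : Continuous ρ) {τ : Fin d} (hτ : π τ = τ) (β : ℝ) {F : GaugeConfig d L G → ℝ}
    (hFm : AEMeasurable F (gibbsProbability (Measure.pi fun _ : Edge d L => haarProbability G)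
      (fun U => Real.exp (-(β * obcAction ρ τ U)))))
    (hF : ∀ U, F (configPerm π U) = -F U) :
    ((gibbsProbability (Measure.pi fun _ : Edge d L => haarProbability G)
        (fun U => Real.exp (-(β * obcAction ρ τ U)))).map F).map Neg.neg =
      (gibbsProbability (Measure.pi fun _ : Edge d L => haarProbability G)
        (fun U => Real.exp (-(β * obcAction ρ τ U)))).map F :=
  Scoring.map_neg_map_of_odd _ (measurePreserving_configPerm_obcGibbs π ρ hρ hτ β) hFm hF

/-- **Odd moments of a `configPerm π`-odd observable vanish**: `∫ F^{2k+1} = 0` (`π τ = τ`). -/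
theorem obcGibbs_integral_pow_odd_of_configPerm_odd (hρ : Continuous ρ) {τ : Fin d} (hτ : π τ = τ) (β : ℝ)
    {F : GaugeConfig d L G → ℝ} (hF : ∀ U, F (configPerm π U) = -F U) (k : ℕ) :
    ∫ U, F U ^ (2 * k + 1) ∂(gibbsProbability (Measure.pi fun _ : Edge d L => haarProbability G)
      (fun U => Real.exp (-(β * obcAction ρ τ U)))) = 0 :=
  Scoring.integral_pow_odd_eq_zero_of_odd _ (measurePreserving_configPerm_obcGibbs π ρ hρ hτ β) hF k

/-- **For every `g`, `∫ g(F) = ∫ g(−F)`** under the open-boundary Gibbs law when `F` is `configPerm π`-odd (`π τ = τ`). -/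
theorem obcGibbs_integral_comp_eq_comp_neg_of_configPerm_odd (hρ : Continuous ρ) {τ : Fin d} (hτ : π τ = τ) (β : ℝ)
    {F : GaugeConfig d L G → ℝ} (hF : ∀ U, F (configPerm π U) = -F U) {V : Type*} [NormedAddCommGroup V] [NormedSpace ℝ V]
    (g : ℝ → V) :
    ∫ U, g (F U) ∂(gibbsProbability (Measure.pi fun _ : Edge d L => haarProbability G)
        (fun U => Real.exp (-(β * obcAction ρ τ U)))) =
      ∫ U, g (-F U) ∂(gibbsProbability (Measure.pi fun _ : Edge d L => haarProbability G)
        (fun U => Real.exp (-(β * obcAction ρ τ U)))) :=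
  Scoring.integral_comp_eq_integral_comp_neg_of_odd _ (measurePreserving_configPerm_obcGibbs π ρ hρ hτ β) hF g

end OddConfigPerm

end Summit.Ventures.LatticeQCDFlow.Exactness
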